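import Summits.MatrixMultiplication.OmegaCensus.SmallFormats.MatMul225GF3MarginalOrbit
import HarnessLib

/-!
# ω-census family (a): the DEFLATION ⟨2,2,n+1⟩ → ⟨2,2,n⟩ keeping the X-forms (any field)

Cell `pub-omega` (unit `pub-omega-tensor`, gen 40), topic `Summits/MatrixMultiplication/OmegaCensus` (sub-folder
`SmallFormats`). Framing (verbatim): lottery ticket; floor = certified bounds/negative ranges. HONEST FRAMING: elementary
substitution bookkeeping, §1 of tensor g40's memo DEFLATION-g40 — the tool that turns a structural statement about the rank-one
layer of a length-`r` computation of `⟨2,2,n+1⟩` («this vector `c` kills the Y-forms of these terms, this covector `ν` kills the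
outputs of those») into a SHORTER computation of `⟨2,2,n⟩` WITH THE SAME X-FORMS on the surviving terms, so that every census clause
of the smaller format applies to the original X-marginal minus the killed classes. Stated as existence theorems (no new definitions).
Nothing here is a bound on any rank by itself; nothing on `ω`.

* `Deflation.exists_deflate` — from `β : BilinComp ⟨2,2,n+1⟩ ι` and matrices `A : n × (n+1)`, `R : (n+1) × n` with `A R = 1`: a
  computation `β'` of `⟨2,2,n⟩` on the same index type with `f' = f`, `g'_i(Y') = g_i(Y'A)`, `w'_i = w_i R` (restrict the inputs to
  `Y = Y'A`, project the outputs by `R`).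
* `Deflation.g_comp_eq_zero` / `w_mul_eq_zero` — KILL CRITERIA: if the Y-form of term `i` is `Y ↦ ∑ η_q c_j Y_{qj}` with `A c = 0`
  then `Y' ↦ g_i(Y'A)` vanishes; if `w_i = ω ⊗ ν` with `ν R = 0` then `w_i R = 0`.
* `Deflation.exists_dropDead` — discard terms whose Y-form or output is zero (sibling of `Literature…dropZero` for `f_i = 0`).
* `Deflation.exists_shorter` — packaged: a set `J` of terms killed on either side yields a computation of `⟨2,2,n⟩` on
  `Fin (|ι| − |J|)` whose X-forms are X-forms of `β` at indices outside `J` (along an injection), and `R(⟨2,2,n⟩) + |J| ≤ |ι|`.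
-/

namespace Summit.MatrixMultiplication.OmegaCensus.SmallFormats

open Finset Module Matrix
open Literature.Computability.AlgebraicComplexity
open Summit.MatrixMultiplication.OmegaCensus.RankOnePlaneCapGeneral

namespace Deflation

variable {k : Type*} [Field k] {n : ℕ} {ι : Type*} [Fintype ι]

/-- **The deflation exists.** Restricting the inputs of a computation of `⟨2,2,n+1⟩` to `Y = Y'A` and projecting its outputs by
`R`, where `A R = 1`, gives a computation of `⟨2,2,n⟩` of the same length with the same X-forms. -/
theorem exists_deflate (β : BilinComp (mulBilin k 2 2 (n + 1)) ι) (A : Matrix (Fin n) (Fin (n + 1)) k)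
    (R : Matrix (Fin (n + 1)) (Fin n) k) (hAR : A * R = 1) :
    ∃ β' : BilinComp (mulBilin k 2 2 n) ι, β'.f = β.f ∧ (∀ i Y', β'.g i Y' = β.g i (Y' * A)) ∧ ∀ i, β'.w i = β.w i * R := by
  let mA : Matrix (Fin 2) (Fin n) k →ₗ[k] Matrix (Fin 2) (Fin (n + 1)) k :=
    { toFun := fun Y => Y * A
      map_add' := fun Y Z => Matrix.add_mul Y Z A
      map_smul' := fun a Y => Matrix.smul_mul a Y A }
  refine ⟨{ f := β.f, g := fun i => (β.g i).comp mA, w := fun i => β.w i * R, map_eq_sum := fun X Y' => ?_ }, rfl,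
    fun i Y' => rfl, fun i => rfl⟩
  have h := β.map_eq_sum X (Y' * A)
  rw [mulBilin_apply] at h
  have h' : X * (Y' * A) * R = (∑ i, (β.f i X * β.g i (Y' * A)) • β.w i) * R := by rw [h]
  rw [Matrix.mul_assoc X, Matrix.mul_assoc Y', hAR, Matrix.mul_one, Matrix.sum_mul] at h'
  rw [mulBilin_apply, h']
  refine Finset.sum_congr rfl fun i _ => ?_
  rw [Matrix.smul_mul]
  rfl

/-- Two computations with the same X-forms have the same X-marginal (restated for convenience). -/
theorem xMarginal_eq_of_f_eq {β : BilinComp (mulBilin k 2 2 (n + 1)) ι} {β' : BilinComp (mulBilin k 2 2 n) ι} (h : β'.f = β.f) :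
    xMarginal β' = xMarginal β := by
  ext i c d
  rw [xMarginal_apply, xMarginal_apply, h]

/-- **Kill criterion, input side.** If the Y-form of a term is `Y ↦ ∑_{q,j} η_q c_j Y_{qj}` (both coefficient rows multiples of one
vector `c`) and `A c = 0`, then `Y' ↦ g(Y'A)` vanishes identically. -/
theorem g_comp_eq_zero (g : Module.Dual k (Matrix (Fin 2) (Fin (n + 1)) k)) (A : Matrix (Fin n) (Fin (n + 1)) k) (η : Fin 2 → k)
    (c : Fin (n + 1) → k) (hg : ∀ Y : Matrix (Fin 2) (Fin (n + 1)) k, g Y = ∑ q, ∑ j, η q * c j * Y q j) (hc : A.mulVec c = 0)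
    (Y' : Matrix (Fin 2) (Fin n) k) : g (Y' * A) = 0 := by
  rw [hg]
  have hrow : ∀ q, ∑ j, η q * c j * (Y' * A) q j = η q * ∑ l, Y' q l * (A.mulVec c) l := by
    intro q
    simp only [Matrix.mul_apply, Matrix.mulVec, dotProduct, Finset.mul_sum]
    rw [Finset.sum_comm]
    refine Finset.sum_congr rfl fun l _ => Finset.sum_congr rfl fun j _ => by ring
  simp only [hrow, hc, Pi.zero_apply, mul_zero, Finset.sum_const_zero]

/-- **Kill criterion, output side.** If both rows of `w` are multiples of one covector `ν` with `ν R = 0`, then `w R = 0`. -/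
theorem w_mul_eq_zero (w : Matrix (Fin 2) (Fin (n + 1)) k) (R : Matrix (Fin (n + 1)) (Fin n) k) (ω : Fin 2 → k)
    (ν : Fin (n + 1) → k) (hw : ∀ p j, w p j = ω p * ν j) (hν : Matrix.vecMul ν R = 0) : w * R = 0 := by
  ext p l
  rw [Matrix.mul_apply, Matrix.zero_apply]
  have : ∑ j, w p j * R j l = ω p * (Matrix.vecMul ν R) l := by
    simp only [hw, Matrix.vecMul, dotProduct, Finset.mul_sum]
    exact Finset.sum_congr rfl fun j _ => by ring
  rw [this, hν, Pi.zero_apply, mul_zero]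

/-- Discarding products whose second form or output vector is zero (sibling of `Literature…dropZero`): the surviving terms, with
the same data, still compute `φ`. -/
theorem exists_dropDead {U V W : Type*} [AddCommGroup U] [Module k U] [AddCommGroup V] [Module k V] [AddCommGroup W]
    [Module k W] {φ : U →ₗ[k] V →ₗ[k] W} [DecidableEq ι] (β : BilinComp φ ι) (J : Finset ι)
    (hJ : ∀ i ∈ J, β.g i = 0 ∨ β.w i = 0) :
    ∃ β' : BilinComp φ {i // i ∉ J}, ∀ i, β'.f i = β.f i.1 ∧ β'.g i = β.g i.1 ∧ β'.w i = β.w i.1 := by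
  refine ⟨{ f := fun i => β.f i.1, g := fun i => β.g i.1, w := fun i => β.w i.1, map_eq_sum := fun u v => ?_ },
    fun i => ⟨rfl, rfl, rfl⟩⟩
  rw [β.map_eq_sum]
  have h1 : ∑ i, (β.f i u * β.g i v) • β.w i
      = ∑ i ∈ Finset.univ.filter (fun i => i ∉ J), (β.f i u * β.g i v) • β.w i := by
    rw [Finset.sum_filter]
    refine Finset.sum_congr rfl fun i _ => ?_
    by_cases hi : i ∉ J
    · simp [hi]
    · rw [not_not] at hi
      rcases hJ i hi with h | h <;> simp [h]
  rw [h1]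
  exact Finset.sum_subtype _ (by simp) (fun i => (β.f i u * β.g i v) • β.w i)

/-- **Deflation with kills, packaged.** From a computation `β` of `⟨2,2,n+1⟩` on `ι`, matrices `A R = 1`, and a set `J` of terms each
killed on the input side (`g_i(Y'A) = 0` for all `Y'`) or on the output side (`w_i R = 0`): a computation of `⟨2,2,n⟩` on
`Fin (|ι| − |J|)` whose X-forms are X-forms of `β` at indices outside `J` (along an injection `e`), and hence
`R(⟨2,2,n⟩) + |J| ≤ |ι|`. -/
theorem exists_shorter [DecidableEq ι] (β : BilinComp (mulBilin k 2 2 (n + 1)) ι) (A : Matrix (Fin n) (Fin (n + 1)) k)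
    (R : Matrix (Fin (n + 1)) (Fin n) k) (hAR : A * R = 1) (J : Finset ι)
    (hJ : ∀ i ∈ J, (∀ Y' : Matrix (Fin 2) (Fin n) k, β.g i (Y' * A) = 0) ∨ β.w i * R = 0) :
    ∃ (β' : BilinComp (mulBilin k 2 2 n) (Fin (Fintype.card ι - J.card))) (e : Fin (Fintype.card ι - J.card) → ι),
      Function.Injective e ∧ (∀ a, e a ∉ J) ∧ (∀ a, β'.f a = β.f (e a)) ∧
      tensorRank (matMulTensor k 2 2 n) + J.card ≤ Fintype.card ι := by
  classical
  obtain ⟨β₀, hf, hg, hw⟩ := exists_deflate β A R hAR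
  have hJ₀ : ∀ i ∈ J, β₀.g i = 0 ∨ β₀.w i = 0 := by
    intro i hi
    rcases hJ i hi with h | h
    · left; ext Y'; rw [hg, h, LinearMap.zero_apply]
    · right; rw [hw, h]
  obtain ⟨β₁, hβ₁⟩ := exists_dropDead β₀ J hJ₀
  have hc : Fintype.card {i // i ∉ J} = Fintype.card ι - J.card := by
    rw [Fintype.card_subtype_compl, Fintype.card_coe]
  let eqv := (Fintype.equivFinOfCardEq hc).symm
  refine ⟨β₁.reindex eqv, fun a => (eqv a).1, fun a b hab => eqv.injective (Subtype.ext hab), fun a => (eqv a).2,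
    fun a => ?_, ?_⟩
  · rw [BilinComp.reindex_f, (hβ₁ (eqv a)).1, hf]
  · have h := RankRowIncrement.tensorRank_le_card (β₁.reindex eqv)
    rw [Fintype.card_fin] at h
    have hJle : J.card ≤ Fintype.card ι := by
      calc J.card ≤ (Finset.univ : Finset ι).card := Finset.card_le_card (Finset.subset_univ J)
        _ = Fintype.card ι := Finset.card_univ
    omega

/-- **Corollary (the form used by the census):** under the hypotheses of `exists_shorter`, `R(⟨2,2,n⟩) + |J| ≤ |ι|`. -/
theorem tensorRank_add_card_le [DecidableEq ι] (β : BilinComp (mulBilin k 2 2 (n + 1)) ι) (A : Matrix (Fin n) (Fin (n + 1)) k)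
    (R : Matrix (Fin (n + 1)) (Fin n) k) (hAR : A * R = 1) (J : Finset ι)
    (hJ : ∀ i ∈ J, (∀ Y' : Matrix (Fin 2) (Fin n) k, β.g i (Y' * A) = 0) ∨ β.w i * R = 0) :
    tensorRank (matMulTensor k 2 2 n) + J.card ≤ Fintype.card ι := by
  obtain ⟨-, -, -, -, -, h⟩ := exists_shorter β A R hAR J hJ
  exact h

end Deflation

end Summit.MatrixMultiplication.OmegaCensus.SmallFormats
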